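import Summits.HodgeConjecture.HodgeConjecture.Theorems.Ring2HypothesesCMPowerTransport
import Summits.HodgeConjecture.HodgeConjecture.Theorems.Ring2TransportDivisorGeneratedAnchors
import Literature.AlgebraicGeometry.HodgeTheory.SurjectivePullbackAlgebraicClasses
import Literature.AlgebraicGeometry.HodgeTheory.DegreeOneHodgeTypes
import Literature.AlgebraicGeometry.HodgeTheory.AbelianVarietyEndomorphismsHOne
import Literature.AlgebraicGeometry.Motives.AbelianVarietyCohomologyExteriorH1
import Literature.AlgebraicGeometry.Motives.AbelianVarietyIsogenyProofs
import HarnessLib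

/-!
# Ring-2 hypotheses layer, part X — `Bᵖ = Dᵖ` UP TO ISOGENY for powers of one CM elliptic curve:
the CM-POWER anchor IS a divisor-generated CM anchor (parts VII-A / VIII / IX merged at the anchor)

HONEST FRAMING (page 1): research route conditional on HC_CM; not a corollary; Q11.4-sentence-2 already refuted in
dim ≥ 3. `HC_CM` = `Theses.RankFourFaces.CMAbelianHodge` (stmt-HodgeConjecture-3052), a binder BY NAME wherever it
occurs; it does not occur in this file. NOTHING here is a new case of the Hodge conjecture: the content is van
Geemen's Theorem 4.3 (Tate) in its printed strength `Bᵖ(X) = Dᵖ(X)` — not only HC(X) — for `X` ISOGENOUS to a power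
of ONE CM elliptic curve, obtained from the Literature seat's generation criterion
(`EllipticCurve.hodgeClasses_divisorial_of_hodgeOneZero_mem_span_pullback`: `Bᵖ(B) ⊆ Dᵖ(B) ⊗ ℂ` whenever the
`(1,0)`-classes of `B` are combinations of pull-backs from `E`) by transporting that criterion along an isogeny.

WHY (parts VII-A / VIII / IX left two CM anchors INCOMPARABLE as typed): the divisor-generated CM anchor
(`divisorGeneratedCMAnchor`: `Hdg = Div` asked ON THE CHART, part VII-A / `Ring2Transport.DivisorGeneratedCMPointed…`)
and the CM-power anchor (`cmPowerAnchor`: chart isogenous to `Eᴺ⁺¹`, part VIII). This file proves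
`cmPowerAnchor ⟹ divisorGeneratedCMAnchor` (row P2), so every divisor-generated row of the layer (W1′, gen-3 transport
rows `…_of_divisorGeneratedCMPointed`) is now ALSO available from the CM-power leaves, and W1‴ / T1–T4 factor through
W1′ / gen 3. The converse fails (a simple CM abelian variety with `B = D` is divisor-generated, not an `E`-power).

| row | Lean name | status | what it says |
|---|---|---|---|
| P0 | `AbelianVariety.exists_hodgeOneZero_map_eq_of_isIsogeny` | PROVED | along an isogeny `f : A → B`, `f^* : H^{1,0}(B) → H^{1,0}(A)` is onto (`f^*` injective on `H¹`, `b₁(A) = b₁(B) = 2 dim`, Hodge decomposition of `H¹`) |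
| P1 | `AbelianVariety.hodgeOneZero_mem_span_pullback_of_isIsogeny` | PROVED | the generation criterion "`H^{1,0}` spanned by pull-backs from `E`" passes from `B` to any `A` isogenous ONTO `B` |
| P1′ | `EllipticCurve.hodgeClasses_divisorial_of_isIsogenous_powSucc_of_cm` | PROVED | **vG Thm. 4.3 up to isogeny, one CM curve, printed strength**: `A ~ Eᴺ⁺¹`, `E` CM elliptic ⟹ every rational `(p,p)` class of `A` lies in `divisorClassesSpan A.X A.dim p` |
| P2 | `divisorGeneratedCMAnchor_of_cmPowerAnchor` | PROVED | CM-power anchor ⟹ divisor-generated CM anchor (part VII-A's predicate) |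
| P3 | `divisorGeneratedCMPointedWeilFamiliesComponent_of_cmPowerPointed`, `divisorGeneratedCMPointedWeilFamiliesQuadratic_of_cmPowerPointed` | PROVED | the CM-power-pointed leaves (parts VIII / IX) imply the divisor-generated CM-pointed leaves (part VII-A / gen 3) |
| P4 | (remark, §3) | — | W1‴ = W1′ ∘ P3 and T2 = gen 3's local row ∘ P3 as composites of landed declarations (not restated) |

HONEST COLUMN. Print scope of vG 4.3 ("isogeneous to a product of elliptic curves", any curves) is still wider than
the kernel's (a power of ONE CM curve): mixed products `∏ Eᵢ^{nᵢ}` of non-isogenous curves are not covered.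
[cite: vanGeemen1994HodgeAV, Lemma 3.7 and Thm. 4.3] [cite: Gordon1997, §3 (Murasaki, Imai)]
[cite: VoisinHodgeI2002, §7.3.2 Lemma 7.28 and Remark 7.29] [cite: MumfordAV1970, §1 (3)]
-/

set_option linter.dupNamespace false

open CategoryTheory AlgebraicGeometry
open Literature.AlgebraicGeometry Literature.AlgebraicGeometry.Motives
open Literature.AlgebraicGeometry.HodgeTheory
open Literature.AlgebraicTopology.SingularHomology
open Literature.AlgebraicGeometry.Milne1999 (IsOfCMType)
open Literature.AlgebraicGeometry.VanGeemen1994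
open Literature.Barriers.HodgeConjecture (divisorClassesSpan)
open Summit.HodgeConjecture.HodgeConjecture.WeilTypeLadder
open Summit.HodgeConjecture.HodgeConjecture.Theses
open Summit.HodgeConjecture.HodgeConjecture.Ring2Transport

namespace Summit.HodgeConjecture.HodgeConjecture.Ring2.Hypotheses

/-! ## §0 Pull-back along an isogeny is onto `H^{1,0}` -/

/-- **P0 — along an isogeny `f : A → B` of complex abelian varieties every `(1,0)`-class of `A` is the pull-back of
a `(1,0)`-class of `B`.** `f^*` is injective on `H¹` (`f` surjective between smooth projective varieties of the
same dimension: `complexBetti_map_injective_of_surjective_of_dim_eq`, Voisin I Rem. 7.29), `b₁(A) = 2 dim A =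
2 dim B = b₁(B)` (`AbelianVariety.finrank_complexBetti_one`, `dim_eq_of_isIsogeny`), so `f^*` is onto `H¹(A)`;
writing a preimage `v = a + b` in `H¹(B) = H^{1,0} ⊕ H^{0,1}`, `f^*b = u - f^*a` is of type `(1,0)` and `(0,1)`,
hence `0`, hence `b = 0`. [cite: VoisinHodgeI2002, §7.3.2 Remark 7.29 and §6.1.3 Cor. 6.14] [cite: MumfordAV1970, §1 (3)] -/
theorem AbelianVariety.exists_hodgeOneZero_map_eq_of_isIsogeny {A B : AbelianVariety ℂ} (f : A ⟶ B)
    (hf : AbelianVariety.IsIsogeny f) (u : complexBetti A.X 1) (hu : IsOfHodgeType A.dim A.X 1 1 0 u) :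
    ∃ v : complexBetti B.X 1, IsOfHodgeType B.dim B.X 1 1 0 v ∧ complexBetti.map f.hom.hom.hom 1 v = u := by
  haveI : Surjective f.hom.hom.hom.left := hf.1
  have hdim : A.dim = B.dim := AbelianVariety.dim_eq_of_isIsogeny hf
  have hA : IsSmoothProjective B.dim A.X := hdim ▸ AbelianVariety.isSmoothProjective_holds
  have hB : IsSmoothProjective B.dim B.X := AbelianVariety.isSmoothProjective_holds
  haveI := finite_complexBetti_abelianVariety A 1
  haveI := finite_complexBetti_abelianVariety B 1
  have hinj : Function.Injective (complexBetti.map f.hom.hom.hom 1) :=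
    complexBetti_map_injective_of_surjective_of_dim_eq hA hB f.hom.hom.hom 1
  have hinj' : Function.Injective (complexBetti.map f.hom.hom.hom 1).hom := hinj
  have hrk : Module.finrank ℂ (complexBetti B.X 1) = Module.finrank ℂ (complexBetti A.X 1) := by
    rw [AbelianVariety.finrank_complexBetti_one, AbelianVariety.finrank_complexBetti_one, hdim]
  have hsurj : Function.Surjective (complexBetti.map f.hom.hom.hom 1).hom :=
    (LinearMap.injective_iff_surjective_of_finrank_eq_finrank hrk).1 hinj'
  obtain ⟨v, hv⟩ := hsurj u
  obtain ⟨a, b, hab, ha, hb⟩ := exists_add_eq_of_isOfHodgeType_one hB v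
  have ha' : IsOfHodgeType B.dim A.X 1 1 0 (complexBetti.map f.hom.hom.hom 1 a) :=
    ha.map_of_isSmoothProjective hA hB _
  have hb' : IsOfHodgeType B.dim A.X 1 0 1 (complexBetti.map f.hom.hom.hom 1 b) :=
    hb.map_of_isSmoothProjective hA hB _
  have hu' : IsOfHodgeType B.dim A.X 1 1 0 u := hdim ▸ hu
  have hfb : (complexBetti.map f.hom.hom.hom 1).hom b = u - (complexBetti.map f.hom.hom.hom 1).hom a := by
    rw [← hv, ← hab, map_add]; abel
  have hb10 : IsOfHodgeType B.dim A.X 1 1 0 ((complexBetti.map f.hom.hom.hom 1).hom b) := by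
    rw [hfb]; exact hu'.sub hA ha'
  have hb0 : (complexBetti.map f.hom.hom.hom 1).hom b = 0 :=
    eq_zero_of_isOfHodgeType_one_zero_of_zero_one hA hb10 hb'
  have hb00 : b = 0 := hinj' (by rw [hb0, map_zero])
  refine ⟨a, ha, ?_⟩
  change (complexBetti.map f.hom.hom.hom 1).hom a = u
  rw [← hv, ← hab, hb00, add_zero]

/-- **P1 — the generation criterion passes along an isogeny**: if the `(1,0)`-classes of `B` are combinations of
pull-backs `g^*w` (`g : B → E`, `w ∈ H^{1,0}(E)`) and `f : A → B` is an isogeny, then the `(1,0)`-classes of `A` are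
combinations of pull-backs `(f ≫ g)^*w`. [cite: vanGeemen1994HodgeAV, Lemma 3.7] [cite: Gordon1997, §3] -/
theorem AbelianVariety.hodgeOneZero_mem_span_pullback_of_isIsogeny (E : AbelianVariety ℂ) {A B : AbelianVariety ℂ}
    (f : A ⟶ B) (hf : AbelianVariety.IsIsogeny f)
    (hB : ∀ u : complexBetti B.X 1, IsOfHodgeType B.dim B.X 1 1 0 u →
      u ∈ Submodule.span ℂ {y : complexBetti B.X 1 | ∃ (g : B ⟶ E) (w : complexBetti E.X 1),
        IsOfHodgeType E.dim E.X 1 1 0 w ∧ y = complexBetti.map g.hom.hom.hom 1 w})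
    (u : complexBetti A.X 1) (hu : IsOfHodgeType A.dim A.X 1 1 0 u) :
    u ∈ Submodule.span ℂ {y : complexBetti A.X 1 | ∃ (g : A ⟶ E) (w : complexBetti E.X 1),
        IsOfHodgeType E.dim E.X 1 1 0 w ∧ y = complexBetti.map g.hom.hom.hom 1 w} := by
  obtain ⟨v, hv, rfl⟩ := AbelianVariety.exists_hodgeOneZero_map_eq_of_isIsogeny f hf u hu
  have hle : Submodule.span ℂ {y : complexBetti B.X 1 | ∃ (g : B ⟶ E) (w : complexBetti E.X 1),
        IsOfHodgeType E.dim E.X 1 1 0 w ∧ y = complexBetti.map g.hom.hom.hom 1 w} ≤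
      (Submodule.span ℂ {y : complexBetti A.X 1 | ∃ (g : A ⟶ E) (w : complexBetti E.X 1),
        IsOfHodgeType E.dim E.X 1 1 0 w ∧ y = complexBetti.map g.hom.hom.hom 1 w}).comap
        (complexBetti.map f.hom.hom.hom 1).hom := by
    refine Submodule.span_le.2 ?_
    rintro _ ⟨g, w, hw, rfl⟩
    refine Submodule.subset_span ⟨f ≫ g, w, hw, ?_⟩
    rw [← complexBetti_map_map_hom]
  exact hle (hB v hv)

/-! ## §1 `Bᵖ = Dᵖ` for abelian varieties isogenous to a power of one CM elliptic curve -/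

section CM

variable {E : AbelianVariety ℂ} (hE : E.dim = 1) (φ : E ⟶ E) {d : ℕ} (hd : 0 < d) (hφ : φ ≫ φ = -(d • 𝟙 E))
include hE hd hφ

/-- **P1′ — van Geemen 1994 Thm. 4.3 (Tate) up to isogeny, one CM curve, in its PRINTED strength `Bᵖ = Dᵖ`**: for
`A` isogenous to `Eᴺ⁺¹`, `E` an elliptic curve with complex multiplication (`φ² = -d`, `d ≥ 1`), every rational
`(p,p)`-class of `A` is a polynomial in divisor classes (`divisorClassesSpan`). The generation criterion holds for
`Eᴺ⁺¹` (`AbelianVariety.hodgeOneZero_mem_span_pullback_powSucc`), passes to `A` along the isogeny (P1), and the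
Literature seat's `EllipticCurve.hodgeClasses_divisorial_of_hodgeOneZero_mem_span_pullback` concludes. UNCONDITIONAL.
[cite: vanGeemen1994HodgeAV, Lemma 3.7 and Thm. 4.3] [cite: Gordon1997, §3 (Murasaki)] -/
theorem EllipticCurve.hodgeClasses_divisorial_of_isIsogenous_powSucc_of_cm (N : ℕ) {A : AbelianVariety ℂ}
    (hA : A.IsIsogenous (E.powSucc N)) (p : ℕ) (c : complexBetti A.X (2 * p)) (hc : IsRationalClass c)
    (hpp : IsOfHodgeType A.dim A.X (2 * p) p p c) : c ∈ divisorClassesSpan A.X A.dim p := by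
  obtain ⟨f, hf⟩ := hA
  exact EllipticCurve.hodgeClasses_divisorial_of_hodgeOneZero_mem_span_pullback hE φ hd hφ A
    (AbelianVariety.hodgeOneZero_mem_span_pullback_of_isIsogeny E f hf
      (AbelianVariety.hodgeOneZero_mem_span_pullback_powSucc E N)) p c hc hpp

end CM

/-! ## §2 The CM-power anchor is a divisor-generated CM anchor -/

/-- **P2 — `cmPowerAnchor n X x → divisorGeneratedCMAnchor n X x`**: the chart `A₀ ~ Eᴺ⁺¹` is of CM type (part VIII
`isOfCMType_of_isIsogenous_powSucc_of_cm`) and all its rational `(n,n)` classes are polynomials in divisor classes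
(P1′). This MERGES part VII-A's divisor-generated line (W1′, gen-3 transport rows) with part VIII's CM-power line:
the latter implies the former at the anchor. [cite: vanGeemen1994HodgeAV, Thm. 4.3] [cite: Milne1999, §2 (p. 54)] -/
theorem divisorGeneratedCMAnchor_of_cmPowerAnchor {n : ℕ} {X : SchemeOver ℂ} {x : complexBetti X (2 * n)}
    (h : cmPowerAnchor n X x) : divisorGeneratedCMAnchor n X x := by
  obtain ⟨A₀, E, ψ, d', N, hiso, hA₀dim, hEdim, hd', hψ, hisog⟩ := h
  exact ⟨A₀, hiso, hA₀dim, isOfCMType_of_isIsogenous_powSucc_of_cm hEdim ψ hd' hψ N hisog,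
    fun y hyQ hypp =>
      EllipticCurve.hodgeClasses_divisorial_of_isIsogenous_powSucc_of_cm hEdim ψ hd' hψ N hisog n y hyQ hypp⟩

/-- **P3 (δ-indexed) — CM-power-pointed `(ℚ(√-d), 2n, δ)`-families are divisor-generated-CM-pointed**
(`PointedWeilFamiliesComponent.mono` with P2). [cite: vanGeemen1994HodgeAV, Thm. 4.3 and 5.5] -/
theorem divisorGeneratedCMPointedWeilFamiliesComponent_of_cmPowerPointed {n d : ℕ} {δ : weilNormResidueGroup d}
    (hP : CMPowerPointedWeilFamiliesComponent n d δ) : DivisorGeneratedCMPointedWeilFamiliesComponent n d δ :=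
  PointedWeilFamiliesComponent.mono (fun _ _ h => divisorGeneratedCMAnchor_of_cmPowerAnchor h) hP

/-- **P3 (transport layer, all discriminants) — CM-power-pointed quadratic Weil families are divisor-generated
CM-pointed** (`Ring2Transport.DivisorGeneratedCMPointedWeilFamiliesQuadratic`, gen 3). [cite: vanGeemen1994HodgeAV, Thm. 4.3] -/
theorem divisorGeneratedCMPointedWeilFamiliesQuadratic_of_cmPowerPointed
    (hP : CMPowerPointedWeilFamiliesQuadratic) : DivisorGeneratedCMPointedWeilFamiliesQuadratic := by
  intro n hn d hd A φ hAdim hX hφ c hcQ hcH hc hc0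
  obtain ⟨𝒳, S, f, s₁, s₀, ι, W, hf, h𝒳, hS, hirrS, hsm, hW, hWeil, hread, hanc⟩ :=
    hP n hn d hd A φ hAdim hX hφ c hcQ hcH hc hc0
  obtain ⟨A₀, hiso, hA₀dim, hA₀cm, hgen⟩ := divisorGeneratedCMAnchor_of_cmPowerAnchor hanc
  exact ⟨𝒳, S, f, s₁, s₀, ι, W, hf, h𝒳, hS, hirrS, hsm, hW, hWeil, hread, A₀, hiso, hA₀dim, hA₀cm, hgen⟩

/-! ## §3 Remark — the two `HC_CM`-free lines coincide at the anchor

W1‴ (part VIII `weilClassesComponent_of_cmPowerPointed'`) is, as a statement, `weilClassesComponent_of_divisorGenerated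
CMPointed ∘ divisorGeneratedCMPointedWeilFamiliesComponent_of_cmPowerPointed`, and T2 (part IX
`HC_WeilClassesQuadratic_of_cmPowerPointed_local`) is `Ring2Transport.HC_WeilClassesQuadratic_of_divisorGeneratedCMPointed_local
∘ divisorGeneratedCMPointedWeilFamiliesQuadratic_of_cmPowerPointed`; the composites are not restated here (they would
duplicate the landed declarations) — cite those. -/

end Summit.HodgeConjecture.HodgeConjecture.Ring2.Hypotheses
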